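import Literature.MeasureTheory.Group.CoveringWeights
import Mathlib.MeasureTheory.Integral.Bochner.ContinuousLinearMap
import Mathlib.MeasureTheory.Function.L1Space.Integrable
import Mathlib.Analysis.Complex.Basic
import HarnessLib

/-!
# From `[0, ∞]`-valued unfolding identities to Bochner integrals

Topic `MeasureTheory/Group`; namespace `Literature.MeasureTheory.Group`. The push-forward
identities of `CoveringWeightsPushforward` / `CoveringWeightsPushforwardSup` (and their
arithmetic instances: unfolding along a torus character, along the idele norm, …) are proved in
the `[0, ∞]`-valued currency

  `∀ u ≥ 0` measurable and invariant, `∫⁻ x, u (α x) * w x ∂μ = K * ∫⁻ y, u y ∂ρ`.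

This file is the (purely measure-theoretic) passage to complex-valued integrands: if two measures
`lam, kap` on `Y` have the same `∫⁻` on every measurable `[0, ∞]`-valued function invariant under a
family of symmetries `S` of `Y`, then every measurable `S`-invariant `g : Y → ℂ` (or `ℝ`) with
`∫⁻ ‖g‖ₑ dλ < ∞` is integrable for both measures and `∫ g dλ = ∫ g dκ` (positive and negative
parts of the real and imaginary parts). The weighted push-forward form — `λ = α_* (w · μ)`,
`κ = K • ρ` — then reads

  `Integrable ((w ·).toReal • g ∘ α) μ`, `Integrable g ρ` (if `K ≠ 0`), and
  `∫ x, (w x).toReal • g (α x) ∂μ = K.toReal * ∫ y, g y ∂ρ`.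

This is the `L¹` clause of Weil's formula [Folland1995, §2.6 Thm. 2.49] in the generality used by
the unfolding files. Everything is proved; no number theory is involved.

## References
* G. B. Folland, *A Course in Abstract Harmonic Analysis* (1995), §2.6, Thm. 2.49 [Folland1995].
* N. Bourbaki, *Intégration*, Ch. VII, §2.
-/

set_option autoImplicit false
noncomputable section

open _root_.MeasureTheory _root_.MeasureTheory.Measure Set Filter Function
open scoped ENNReal NNReal

namespace Literature.MeasureTheory.Group

section TwoMeasures

variable {Y : Type*} [MeasurableSpace Y] (lam kap : Measure Y) (S : Set (Y → Y))

/-- **Nonnegative real integrands.** If `lam` and `kap` have the same `∫⁻` on measurable `S`-invariant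
`[0, ∞]`-valued functions, then for a measurable `S`-invariant `u ≥ 0` with `∫⁻ u dλ < ∞`:
`u ∈ L¹(λ) ∩ L¹(κ)` and `∫ u dλ = ∫ u dκ`. [cite: Folland1995, §2.6 Thm. 2.49] -/
theorem integral_eq_of_forall_lintegral_eq_of_nonneg
    (hId : ∀ u : Y → ℝ≥0∞, Measurable u → (∀ σ ∈ S, ∀ y, u (σ y) = u y) →
      ∫⁻ y, u y ∂lam = ∫⁻ y, u y ∂kap)
    {u : Y → ℝ} (hu : Measurable u) (huinv : ∀ σ ∈ S, ∀ y, u (σ y) = u y) (hu0 : ∀ y, 0 ≤ u y)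
    (hfin : ∫⁻ y, ENNReal.ofReal (u y) ∂lam < ∞) :
    Integrable u lam ∧ Integrable u kap ∧ ∫ y, u y ∂lam = ∫ y, u y ∂kap := by
  have hmeas : Measurable fun y => ENNReal.ofReal (u y) := ENNReal.measurable_ofReal.comp hu
  have hinv : ∀ σ ∈ S, ∀ y, ENNReal.ofReal (u (σ y)) = ENNReal.ofReal (u y) := by
    intro σ hσ y; rw [huinv σ hσ y]
  have heq := hId _ hmeas hinv
  refine ⟨⟨hu.aestronglyMeasurable, (hasFiniteIntegral_iff_ofReal (ae_of_all _ hu0)).2 hfin⟩,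
    ⟨hu.aestronglyMeasurable, (hasFiniteIntegral_iff_ofReal (ae_of_all _ hu0)).2 (heq ▸ hfin)⟩, ?_⟩
  rw [integral_eq_lintegral_of_nonneg_ae (ae_of_all _ hu0) hu.aestronglyMeasurable,
    integral_eq_lintegral_of_nonneg_ae (ae_of_all _ hu0) hu.aestronglyMeasurable, heq]

/-- **Real integrands.** Same hypothesis on `lam, kap`; for a measurable `S`-invariant `u : Y → ℝ` with
`∫⁻ ‖u‖ₑ dλ < ∞`: `u ∈ L¹(λ) ∩ L¹(κ)` and `∫ u dλ = ∫ u dκ` (split `u = u⁺ − u⁻`).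
[cite: Folland1995, §2.6 Thm. 2.49] -/
theorem integral_eq_of_forall_lintegral_eq_real
    (hId : ∀ u : Y → ℝ≥0∞, Measurable u → (∀ σ ∈ S, ∀ y, u (σ y) = u y) →
      ∫⁻ y, u y ∂lam = ∫⁻ y, u y ∂kap)
    {u : Y → ℝ} (hu : Measurable u) (huinv : ∀ σ ∈ S, ∀ y, u (σ y) = u y)
    (hfin : ∫⁻ y, ‖u y‖ₑ ∂lam < ∞) :
    Integrable u lam ∧ Integrable u kap ∧ ∫ y, u y ∂lam = ∫ y, u y ∂kap := by
  -- integrability for `κ` straight from the identity applied to `‖u‖ₑ`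
  have hmeasn : Measurable fun y => ‖u y‖ₑ := hu.enorm
  have hinvn : ∀ σ ∈ S, ∀ y, ‖u (σ y)‖ₑ = ‖u y‖ₑ := by intro σ hσ y; rw [huinv σ hσ y]
  have heqn := hId _ hmeasn hinvn
  have hI1 : Integrable u lam := ⟨hu.aestronglyMeasurable, hasFiniteIntegral_iff_enorm.2 hfin⟩
  have hI2 : Integrable u kap := ⟨hu.aestronglyMeasurable, hasFiniteIntegral_iff_enorm.2 (heqn ▸ hfin)⟩
  refine ⟨hI1, hI2, ?_⟩
  -- positive and negative parts
  have hle : ∀ y, ENNReal.ofReal (max (u y) 0) ≤ ‖u y‖ₑ ∧ ENNReal.ofReal (max (-u y) 0) ≤ ‖u y‖ₑ := by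
    intro y
    rw [Real.enorm_eq_ofReal_abs]
    exact ⟨ENNReal.ofReal_le_ofReal (max_le (le_abs_self _) (abs_nonneg _)),
      ENNReal.ofReal_le_ofReal (max_le (neg_le_abs _) (abs_nonneg _))⟩
  have hp := integral_eq_of_forall_lintegral_eq_of_nonneg lam kap S hId (u := fun y => max (u y) 0)
    (hu.max measurable_const) (fun σ hσ y => by rw [huinv σ hσ y])
    (fun y => le_max_right (u y) 0) (lt_of_le_of_lt (lintegral_mono fun y => (hle y).1) hfin)
  have hn := integral_eq_of_forall_lintegral_eq_of_nonneg lam kap S hId (u := fun y => max (-u y) 0)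
    (hu.neg.max measurable_const) (fun σ hσ y => by rw [huinv σ hσ y])
    (fun y => le_max_right (-u y) 0) (lt_of_le_of_lt (lintegral_mono fun y => (hle y).2) hfin)
  calc ∫ y, u y ∂lam = ∫ y, (max (u y) 0 - max (-u y) 0) ∂lam := by
        simp only [max_zero_sub_max_neg_zero_eq_self]
    _ = ∫ y, max (u y) 0 ∂lam - ∫ y, max (-u y) 0 ∂lam := integral_sub hp.1 hn.1
    _ = ∫ y, max (u y) 0 ∂kap - ∫ y, max (-u y) 0 ∂kap := by rw [hp.2.2, hn.2.2]
    _ = ∫ y, (max (u y) 0 - max (-u y) 0) ∂kap := (integral_sub hp.2.1 hn.2.1).symm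
    _ = ∫ y, u y ∂kap := by simp only [max_zero_sub_max_neg_zero_eq_self]

/-- **Complex integrands.** If `lam` and `kap` have the same `∫⁻` on measurable `S`-invariant
`[0, ∞]`-valued functions, then for a measurable `S`-invariant `g : Y → ℂ` with `∫⁻ ‖g‖ₑ dλ < ∞`:
`g ∈ L¹(λ) ∩ L¹(κ)` and `∫ g dλ = ∫ g dκ` (real and imaginary parts).
[cite: Folland1995, §2.6 Thm. 2.49] -/
theorem integral_eq_of_forall_lintegral_eq
    (hId : ∀ u : Y → ℝ≥0∞, Measurable u → (∀ σ ∈ S, ∀ y, u (σ y) = u y) →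
      ∫⁻ y, u y ∂lam = ∫⁻ y, u y ∂kap)
    {g : Y → ℂ} (hg : Measurable g) (hginv : ∀ σ ∈ S, ∀ y, g (σ y) = g y)
    (hfin : ∫⁻ y, ‖g y‖ₑ ∂lam < ∞) :
    Integrable g lam ∧ Integrable g kap ∧ ∫ y, g y ∂lam = ∫ y, g y ∂kap := by
  have hmeasn : Measurable fun y => ‖g y‖ₑ := hg.enorm
  have hinvn : ∀ σ ∈ S, ∀ y, ‖g (σ y)‖ₑ = ‖g y‖ₑ := by intro σ hσ y; rw [hginv σ hσ y]
  have heqn := hId _ hmeasn hinvn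
  have hI1 : Integrable g lam := ⟨hg.aestronglyMeasurable, hasFiniteIntegral_iff_enorm.2 hfin⟩
  have hI2 : Integrable g kap := ⟨hg.aestronglyMeasurable, hasFiniteIntegral_iff_enorm.2 (heqn ▸ hfin)⟩
  refine ⟨hI1, hI2, ?_⟩
  have hle : ∀ y, ‖(g y).re‖ₑ ≤ ‖g y‖ₑ ∧ ‖(g y).im‖ₑ ≤ ‖g y‖ₑ := by
    intro y
    simp only [← ofReal_norm, Real.norm_eq_abs]
    exact ⟨ENNReal.ofReal_le_ofReal (Complex.abs_re_le_norm _),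
      ENNReal.ofReal_le_ofReal (Complex.abs_im_le_norm _)⟩
  have hre := integral_eq_of_forall_lintegral_eq_real lam kap S hId (u := fun y => (g y).re)
    (Complex.measurable_re.comp hg) (fun σ hσ y => by rw [hginv σ hσ y])
    (lt_of_le_of_lt (lintegral_mono fun y => (hle y).1) hfin)
  have him := integral_eq_of_forall_lintegral_eq_real lam kap S hId (u := fun y => (g y).im)
    (Complex.measurable_im.comp hg) (fun σ hσ y => by rw [hginv σ hσ y])
    (lt_of_le_of_lt (lintegral_mono fun y => (hle y).2) hfin)
  apply Complex.ext
  · have h1 := integral_re hI1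
    have h2 := integral_re hI2
    simp only [RCLike.re_to_complex] at h1 h2
    rw [← h1, ← h2]
    exact hre.2.2
  · have h1 := integral_im hI1
    have h2 := integral_im hI2
    simp only [RCLike.im_to_complex] at h1 h2
    rw [← h1, ← h2]
    exact him.2.2

end TwoMeasures

section WeightedPushforward

variable {X Y : Type*} [MeasurableSpace X] [MeasurableSpace Y]

/-- The `[0, ∞]`-valued integral against the weighted push-forward `α_* (w · μ)` is
`∫⁻ x, u (α x) * w x ∂μ`. [folklore] -/
private theorem lintegral_map_withDensity_eq (μ : Measure X) {α : X → Y} (hα : Measurable α)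
    {w : X → ℝ≥0∞} (hw : Measurable w) {u : Y → ℝ≥0∞} (hu : Measurable u) :
    ∫⁻ y, u y ∂((μ.withDensity w).map α) = ∫⁻ x, u (α x) * w x ∂μ := by
  rw [lintegral_map hu hα, show (fun a => u (α a)) = u ∘ α from rfl,
    lintegral_withDensity_eq_lintegral_mul μ hw (hu.comp hα)]
  congr 1; funext x; simp only [Pi.mul_apply, Function.comp_apply, mul_comm]

/-- **THE BOCHNER BRIDGE for weighted push-forward identities.** Let `α : X → Y` and
`w : X → [0, ∞]` be measurable with `w < ∞` a.e., `K ∈ [0, ∞)`, `ρ` a measure on `Y`, and suppose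
the `[0, ∞]`-valued unfolding identity
`∫⁻ x, u (α x) * w x ∂μ = K * ∫⁻ y, u y ∂ρ` holds for every measurable `u ≥ 0` invariant under
the symmetries `S`. Then for every measurable `S`-invariant `g : Y → ℂ` with
`∫⁻ x, ‖g (α x)‖ₑ * w x ∂μ < ∞`: `x ↦ (w x).toReal • g (α x)` is `μ`-integrable, `g` is
`ρ`-integrable if `K ≠ 0`, and `∫ x, (w x).toReal • g (α x) ∂μ = K.toReal * ∫ y, g y ∂ρ`.
[cite: Folland1995, §2.6 Thm. 2.49] -/
theorem integrable_and_integral_eq_of_forall_lintegral_comp_mul_eq (μ : Measure X) (ρ : Measure Y)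
    (S : Set (Y → Y)) {α : X → Y} (hα : Measurable α) {w : X → ℝ≥0∞} (hw : Measurable w)
    (hwfin : ∀ᵐ x ∂μ, w x < ∞) {K : ℝ≥0∞} (hK : K ≠ ∞)
    (hId : ∀ u : Y → ℝ≥0∞, Measurable u → (∀ σ ∈ S, ∀ y, u (σ y) = u y) →
      ∫⁻ x, u (α x) * w x ∂μ = K * ∫⁻ y, u y ∂ρ)
    {g : Y → ℂ} (hg : Measurable g) (hginv : ∀ σ ∈ S, ∀ y, g (σ y) = g y)
    (hfin : ∫⁻ x, ‖g (α x)‖ₑ * w x ∂μ < ∞) :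
    Integrable (fun x => (w x).toReal • g (α x)) μ ∧ (K ≠ 0 → Integrable g ρ) ∧
      ∫ x, (w x).toReal • g (α x) ∂μ = (K.toReal : ℂ) * ∫ y, g y ∂ρ := by
  -- the two measures on `Y`
  have hId' : ∀ u : Y → ℝ≥0∞, Measurable u → (∀ σ ∈ S, ∀ y, u (σ y) = u y) →
      ∫⁻ y, u y ∂((μ.withDensity w).map α) = ∫⁻ y, u y ∂(K • ρ) := by
    intro u hu huinv
    rw [lintegral_map_withDensity_eq μ hα hw hu, lintegral_smul_measure, hId u hu huinv, smul_eq_mul]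
  have hfin' : ∫⁻ y, ‖g y‖ₑ ∂((μ.withDensity w).map α) < ∞ := by
    rw [lintegral_map_withDensity_eq μ hα hw hg.enorm]; exact hfin
  obtain ⟨hI1, hI2, hint⟩ := integral_eq_of_forall_lintegral_eq _ _ S hId' hg hginv hfin'
  -- unpack the left measure
  have hI1' : Integrable (fun x => (w x).toReal • g (α x)) μ := by
    have h := (integrable_map_measure hg.aestronglyMeasurable hα.aemeasurable).1 hI1
    exact (integrable_withDensity_iff_integrable_smul' hw hwfin).1 h
  have hint1 : ∫ y, g y ∂((μ.withDensity w).map α) = ∫ x, (w x).toReal • g (α x) ∂μ := by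
    rw [integral_map hα.aemeasurable hg.aestronglyMeasurable,
      integral_withDensity_eq_integral_toReal_smul hw hwfin]
  -- unpack the right measure
  have hint2 : ∫ y, g y ∂(K • ρ) = (K.toReal : ℂ) * ∫ y, g y ∂ρ := by
    rw [integral_smul_measure, Complex.real_smul]
  refine ⟨hI1', fun hK0 => (integrable_smul_measure hK0 hK).1 hI2, ?_⟩
  rw [← hint1, hint, hint2]

/-- **The same with invariance under left multiplication by a subset `Γ`** (the shape of the
arithmetic unfolding identities: `∀ k ∈ Γ, ∀ y, u (k * y) = u y`), and with `ρ` allowed to be a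
restricted measure `ρ.restrict s` so that `∫⁻ y in s, _ ∂ρ` / `∫ y in s, _ ∂ρ` dock literally.
[cite: Folland1995, §2.6 Thm. 2.49] -/
theorem integrable_and_setIntegral_eq_of_forall_lintegral_comp_mul_eq [Mul Y] (μ : Measure X)
    (ρ : Measure Y) (s : Set Y) (Γ : Set Y) {α : X → Y} (hα : Measurable α) {w : X → ℝ≥0∞}
    (hw : Measurable w) (hwfin : ∀ᵐ x ∂μ, w x < ∞) {K : ℝ≥0∞} (hK : K ≠ ∞)
    (hId : ∀ u : Y → ℝ≥0∞, Measurable u → (∀ k ∈ Γ, ∀ y, u (k * y) = u y) →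
      ∫⁻ x, u (α x) * w x ∂μ = K * ∫⁻ y in s, u y ∂ρ)
    {g : Y → ℂ} (hg : Measurable g) (hginv : ∀ k ∈ Γ, ∀ y, g (k * y) = g y)
    (hfin : ∫⁻ x, ‖g (α x)‖ₑ * w x ∂μ < ∞) :
    Integrable (fun x => (w x).toReal • g (α x)) μ ∧ (K ≠ 0 → IntegrableOn g s ρ) ∧
      ∫ x, (w x).toReal • g (α x) ∂μ = (K.toReal : ℂ) * ∫ y in s, g y ∂ρ := by
  have hS : ∀ u : Y → ℝ≥0∞, (∀ σ ∈ (fun k : Y => fun y : Y => k * y) '' Γ, ∀ y, u (σ y) = u y) →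
      ∀ k ∈ Γ, ∀ y, u (k * y) = u y := by
    intro u; simp only [Set.forall_mem_image]; exact id
  have hSg : ∀ σ ∈ (fun k : Y => fun y : Y => k * y) '' Γ, ∀ y, g (σ y) = g y := by
    simp only [Set.forall_mem_image]; exact hginv
  exact integrable_and_integral_eq_of_forall_lintegral_comp_mul_eq μ (ρ.restrict s)
    ((fun k : Y => fun y : Y => k * y) '' Γ) hα hw hwfin hK
    (fun u hu huinv => hId u hu (hS u huinv)) hg hSg hfin

end WeightedPushforward

end Literature.MeasureTheory.Group
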